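import Summits.KontsevichZagierPeriods.KontsevichZagierPeriods.Theorems.LiouvilleUnfoldingLogPrimitiveNLStructureEngineCell
import Summits.KontsevichZagierPeriods.KontsevichZagierPeriods.Theorems.LiouvilleUnfoldingLogPrimitiveNLStubDescentIntegrateBack
import Summits.KontsevichZagierPeriods.KontsevichZagierPeriods.Theorems.GammaHodgeSector.Negative.Algebraicity
import HarnessLib

/-!
# `LogPrimitiveNL` (stmt-KontsevichZagierPeriods-2836), line `ax-schanuel-germs` — the registered stub
`stub_structure` (structure theorem for semialgebraic log-linear identities)

From the cell engine (`engine_cell`, part E), the constant block (stub `stub_constBlockDescent`, as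
hypothesis: Baker in relation-span form), the rational reproducing matrix
(`descent_lattice_reproduce`, landed by line `logderiv-peeling`) and the uniform cells (stub
`stub_uniformCells`, as hypothesis): on each cell `g ≡ 0` and `h = Σ_r q_r f_r` with `q_r`
`ℚ`-semialgebraic and `Π Wᵢ^{f_r i} ≡ 1`; assembled over the cells this is EXACTLY the registered
stub `stub_structure`, whose conclusion is that of `stub_descent` of line `logderiv-peeling` (shared
fold glue). [folklore assembly of the line's stubs]
-/

noncomputable section

open Set Filter MvPolynomial MeasureTheory
open scoped ContDiff Topology LaurentSeries RatFunc Polynomial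
open Literature.NumberTheory.Transcendental Literature.ModelTheory.ExponentialFields

namespace Summit.KontsevichZagierPeriods.LiouvilleUnfolding.LogPrimitiveNL.AxSchanuelGerms

-- canonical `ℤ`-algebra structure on `ℝ⸨X⸩` (see part C)
attribute [local instance 10000] Ring.toIntAlgebra

/-! ### Part F: constant block, reproduction, and the structure theorem -/

section Assembly

/-- `Σ fᵢ log wᵢ = log Π wᵢ^{fᵢ}` for positive reals. [folklore] -/
theorem sum_intCast_mul_log {k : ℕ} (f : Fin k → ℤ) (w : Fin k → ℝ) (hw : ∀ i, 0 < w i) :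
    ∑ i, (f i : ℝ) * Real.log (w i) = Real.log (∏ i, w i ^ (f i)) := by
  rw [Real.log_prod]
  · exact Finset.sum_congr rfl fun i _ => (Real.log_zpow (w i) (f i)).symm
  · intro i _
    exact (zpow_pos (hw i) _).ne'

/-- Monomial algebra through logarithms: `Π wᵢ^{Σ_r m_r f_{ri}} = Π_r (Π wᵢ^{f_{ri}})^{m_r}` for
positive reals. [folklore] -/
theorem prod_zpow_sum_eq {k R : ℕ} (w : Fin k → ℝ) (hw : ∀ i, 0 < w i) (f : Fin R → Fin k → ℤ)
    (m : Fin R → ℤ) :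
    ∏ i, w i ^ (∑ r, m r * f r i) = ∏ r, (∏ i, w i ^ (f r i)) ^ (m r) := by
  have hpos1 : 0 < ∏ i, w i ^ (∑ r, m r * f r i) :=
    Finset.prod_pos fun i _ => zpow_pos (hw i) _
  have hposr : ∀ r, 0 < ∏ i, w i ^ (f r i) := fun r => Finset.prod_pos fun i _ => zpow_pos (hw i) _
  have hpos2 : 0 < ∏ r, (∏ i, w i ^ (f r i)) ^ (m r) := Finset.prod_pos fun r _ => zpow_pos (hposr r) _
  apply Real.log_injOn_pos (Set.mem_Ioi.2 hpos1) (Set.mem_Ioi.2 hpos2)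
  rw [← sum_intCast_mul_log _ _ hw, ← sum_intCast_mul_log _ _ hposr]
  simp_rw [← sum_intCast_mul_log _ _ hw]
  simp only [Int.cast_sum, Int.cast_mul, Finset.sum_mul, Finset.mul_sum]
  rw [Finset.sum_comm]
  refine Finset.sum_congr rfl fun r _ => Finset.sum_congr rfl fun i _ => ?_
  ring

/-- **Rational reproduction of a semialgebraic vector field on a lattice span.** If the
`ℚ`-semialgebraic functions `hᵢ` take, on `C`, values in the real span of the integer vectors of a
set `S`, then `h = Σ_r q_r f_r` on `C` with finitely many `f_r ∈ S` and coefficient functions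
`q_r` which are fixed RATIONAL linear combinations of the `hᵢ` (hence `ℚ`-semialgebraic).
[folklore] -/
theorem reproduce_on_span {n k : ℕ} {C : Set (Fin n → ℝ)} (hCs : IsSemialgebraic ℚ C)
    (h : Fin k → (Fin n → ℝ) → ℝ) (hhs : ∀ i, IsSemialgebraicFunOn ℚ C (h i))
    (S : Set (Fin k → ℤ))
    (hmem : ∀ x ∈ C, (fun i => h i x) ∈
      Submodule.span ℝ {φ : Fin k → ℝ | ∃ f ∈ S, φ = fun i => (f i : ℝ)}) :
    ∃ (R : ℕ) (f : Fin R → Fin k → ℤ) (Bq : Fin R → Fin k → ℚ), (∀ r, f r ∈ S) ∧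
      (∀ r, IsSemialgebraicFunOn ℚ C (fun x => ∑ i', (Bq r i' : ℝ) * h i' x)) ∧
      ∀ i, ∀ x ∈ C, h i x = ∑ r, (∑ i', (Bq r i' : ℝ) * h i' x) * (f r i : ℝ) := by
  classical
  -- a finite linearly independent spanning family inside the generating set
  set G : Set (Fin k → ℝ) := {φ : Fin k → ℝ | ∃ f ∈ S, φ = fun i => (f i : ℝ)} with hG
  obtain ⟨b, hbG, hbspan, hbli⟩ := exists_linearIndependent ℝ G
  have hbfin : b.Finite := hbli.setFinite
  obtain ⟨R, emb, hrange⟩ := hbfin.fin_embedding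
  have hf : ∀ r : Fin R, ∃ f ∈ S, (emb r : Fin k → ℝ) = fun i => (f i : ℝ) := fun r =>
    hbG (hrange ▸ Set.mem_range_self r)
  choose f hfS hfe using hf
  obtain ⟨Bq, hBq⟩ := descent_lattice_reproduce k f
  refine ⟨R, f, Bq, hfS, fun r => ?_, fun i x hx => ?_⟩
  · exact IsSemialgebraicFunOn.fun_finsetSum Finset.univ hCs fun i' _ =>
      IsSemialgebraicFunOn.fun_mul (isSemialgebraicFunOn_const_ratCast hCs (Bq r i')) (hhs i')
  · -- `h x` in the span of the `f r`
    have hspan : (fun i => h i x) ∈ Submodule.span ℝ (Set.range fun r : Fin R => fun i => (f r i : ℝ)) := by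
      have h1 : (fun i => h i x) ∈ Submodule.span ℝ b := by rw [hbspan]; exact hmem x hx
      have hrange' : (Set.range fun r : Fin R => fun i => (f r i : ℝ)) = b := by
        rw [← hrange]
        ext φ
        constructor
        · rintro ⟨r, rfl⟩
          exact ⟨r, hfe r⟩
        · rintro ⟨r, rfl⟩
          exact ⟨r, (hfe r).symm⟩
      rwa [hrange']
    obtain ⟨a, ha⟩ := (Submodule.mem_span_range_iff_exists_fun ℝ).1 hspan
    have hai : ∀ i', h i' x = ∑ r₀, a r₀ * (f r₀ i' : ℝ) := fun i' => by
      have := congr_fun ha i'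
      simpa [Finset.sum_apply, Pi.smul_apply, smul_eq_mul] using this.symm
    -- reproduce
    have hrep : ∀ r₀ i, (f r₀ i : ℝ) = ∑ r, (∑ i', (Bq r i' : ℝ) * (f r₀ i' : ℝ)) * (f r i : ℝ) := by
      intro r₀ i
      have := congr_arg (fun q : ℚ => (q : ℝ)) (hBq r₀ i)
      push_cast at this
      exact this
    calc h i x = ∑ r₀, a r₀ * (f r₀ i : ℝ) := hai i
      _ = ∑ r₀, a r₀ * ∑ r, (∑ i', (Bq r i' : ℝ) * (f r₀ i' : ℝ)) * (f r i : ℝ) := by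
          refine Finset.sum_congr rfl fun r₀ _ => ?_
          rw [← hrep r₀ i]
      _ = ∑ r, (∑ i', (Bq r i' : ℝ) * h i' x) * (f r i : ℝ) := by
          simp only [hai, Finset.mul_sum, Finset.sum_mul]
          rw [Finset.sum_comm]
          refine Finset.sum_congr rfl fun r _ => ?_
          rw [Finset.sum_comm]
          refine Finset.sum_congr rfl fun i' _ => Finset.sum_congr rfl fun r₀ _ => ?_
          ring

end Assembly

section CellStructure

/-- **Structure on one uniform cell** (engine + constant block + rational reproduction): on an
open `ℚ`-semialgebraic cell with smooth data, positive `Wᵢ`, `Σ hᵢ log Wᵢ = g` and the uniformity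
dichotomy, `g ≡ 0` and `h = Σ_r q_r f_r` with `q_r` `ℚ`-semialgebraic and `Π Wᵢ^{f_r i} ≡ 1` —
given the six engine stubs as hypotheses. [folklore] -/
theorem structure_on_cell
    (hT : ∃ T : (ℝ → ℝ) → ℝ⸨X⸩,
      (∀ f g : ℝ → ℝ, f =ᶠ[𝓝 0] g → T f = T g) ∧
      (∀ f g : ℝ → ℝ, (∃ U ∈ 𝓝 (0 : ℝ), ContDiffOn ℝ ∞ f U) →
        (∃ U ∈ 𝓝 (0 : ℝ), ContDiffOn ℝ ∞ g U) →
          T (f + g) = T f + T g ∧ T (f * g) = T f * T g) ∧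
      (∀ f : ℝ → ℝ, (∃ U ∈ 𝓝 (0 : ℝ), ContDiffOn ℝ ∞ f U) →
        T (deriv f) = LaurentSeries.derivative ℝ (T f)) ∧
      (∀ c : ℝ, T (fun _ => c) = HahnSeries.C c) ∧
      T (fun t => t) = HahnSeries.single 1 1 ∧
      (∀ f : ℝ → ℝ, ∃ p : PowerSeries ℝ, T f = HahnSeries.ofPowerSeries ℤ ℝ p) ∧
      (∀ f : ℝ → ℝ, (T f).coeff 0 = f 0) ∧
      (∀ f : ℝ → ℝ, (∃ U ∈ 𝓝 (0 : ℝ), ContDiffOn ℝ ∞ f U) →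
        (T f = 0 ↔ ∀ n : ℕ, iteratedDeriv n f 0 = 0)))
    (hpoly : ∀ (φ : ℝ → ℝ) (a b : ℝ), a < b →
      IsSemialgebraicFunOn ℝ {x : Fin 1 → ℝ | x 0 ∈ Ioo a b} (fun x => φ (x 0)) →
        ∃ q : MvPolynomial (Fin 2) ℝ, q ≠ 0 ∧
          ∀ t ∈ Ioo a b, MvPolynomial.eval (Fin.cons (φ t) fun _ => t) q = 0)
    (hflat : ∀ (φ : ℝ → ℝ) (ε : ℝ), 0 < ε →
      IsSemialgebraicFunOn ℝ {x : Fin 1 → ℝ | x 0 ∈ Ioo (-ε) ε} (fun x => φ (x 0)) →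
        ContDiffOn ℝ ∞ φ (Ioo (-ε) ε) → (∀ n : ℕ, iteratedDeriv n φ 0 = 0) →
          ∀ᶠ t in 𝓝 (0 : ℝ), φ t = 0)
    (hstab : ∀ x : ℝ⸨X⸩, IsAlgebraic (RatFunc ℝ) x →
      IsAlgebraic (RatFunc ℝ) (LaurentSeries.derivative ℝ x))
    (hRP : ∀ (m : ℕ) (e : Fin m → ℝ) (u : Fin m → ℝ⸨X⸩) (v : ℝ⸨X⸩), LinearIndependent ℚ e →
      (∀ j, IsAlgebraic (RatFunc ℝ) (u j)) → (∀ j, u j ≠ 0) → IsAlgebraic (RatFunc ℝ) v →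
      (∑ j, HahnSeries.C (e j) * ((u j)⁻¹ * LaurentSeries.derivative ℝ (u j))) +
          LaurentSeries.derivative ℝ v = 0 →
        ∀ j, LaurentSeries.derivative ℝ (u j) = 0)
    (habs : ∀ (L : Type) [Field L] [CharZero L] (D : Derivation ℤ L L) (F : Subfield L),
      (∀ x ∈ F, D x ∈ F) → (∀ x, D x = 0 → x ∈ F) →
      (∀ (m : ℕ) (c u : Fin m → L) (v : L), (∀ j, D (c j) = 0) → LinearIndependent ℚ c →
        (∀ j, u j ∈ F) → (∀ j, u j ≠ 0) → v ∈ F →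
        (∑ j, c j * ((u j)⁻¹ * D (u j))) + D v = 0 → ∀ j, D (u j) = 0) →
      ∀ (k : ℕ) (η w y : Fin k → L) (g : L), (∀ i, η i ∈ F) → (∀ i, w i ∈ F) →
        (∀ i, w i ≠ 0) → (∀ i, D (y i) = (w i)⁻¹ * D (w i)) → g ∈ F →
        ∑ i, η i * y i = g →
        ∀ p : Fin k → ℤ,
          (∀ f : Fin k → ℤ, D (∑ i, (f i : L) * y i) = 0 → ∑ i, p i * f i = 0) →
          ∑ i, (p i : L) * η i = 0)
    (horth : ∀ (k : ℕ) (S : Set (Fin k → ℤ)) (v : Fin k → ℝ),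
      (∀ p : Fin k → ℤ, (∀ f ∈ S, ∑ i, p i * f i = 0) → ∑ i, (p i : ℝ) * v i = 0) →
      v ∈ Submodule.span ℝ {φ : Fin k → ℝ | ∃ f ∈ S, φ = fun i => (f i : ℝ)})
    (hconst : ∀ (n R : ℕ) (C : Set (Fin n → ℝ)) (q : Fin R → (Fin n → ℝ) → ℝ) (g : (Fin n → ℝ) → ℝ)
      (θ : Fin R → ℝ), IsSemialgebraic ℚ C → IsOpen C →
      (∀ r, IsSemialgebraicFunOn ℚ C (q r)) → (∀ r, ContinuousOn (q r) C) →
      IsSemialgebraicFunOn ℚ C g → (∀ r, IsAlgebraic ℚ (θ r)) → (∀ r, 0 < θ r) →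
      (∀ x ∈ C, ∑ r, q r x * Real.log (θ r) = g x) →
      ∀ x ∈ C, (fun r => q r x) ∈ Submodule.span ℝ
        {φ : Fin R → ℝ | ∃ m : Fin R → ℤ, ∏ r, θ r ^ (m r) = 1 ∧ φ = fun r => (m r : ℝ)})
    {n k : ℕ} {C : Set (Fin n → ℝ)} (hCs : IsSemialgebraic ℚ C) (hCo : IsOpen C)
    (h W : Fin k → (Fin n → ℝ) → ℝ) (g : (Fin n → ℝ) → ℝ)
    (hhs : ∀ i, IsSemialgebraicFunOn ℚ C (h i)) (hWs : ∀ i, IsSemialgebraicFunOn ℚ C (W i))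
    (hgs : IsSemialgebraicFunOn ℚ C g)
    (hhc : ∀ i, ContDiffOn ℝ ∞ (h i) C) (hWc : ∀ i, ContDiffOn ℝ ∞ (W i) C)
    (hgc : ContDiffOn ℝ ∞ g C) (hWpos : ∀ i, ∀ x ∈ C, 0 < W i x)
    (hrel : ∀ x ∈ C, ∑ i, h i x * Real.log (W i x) = g x)
    (hdich : ∀ f : Fin k → ℤ, (∃ θ : ℝ, ∀ x ∈ C, ∏ i, W i x ^ (f i) = θ) ∨
      interior {x ∈ C | ∀ j : Fin n,
        ∑ i, (f i : ℝ) * (fderiv ℝ (W i) x (Pi.single j 1) / W i x) = 0} = ∅) :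
    (∀ x ∈ C, g x = 0) ∧
      ∃ (R : ℕ) (f : Fin R → Fin k → ℤ) (q : Fin R → (Fin n → ℝ) → ℝ),
        (∀ r, IsSemialgebraicFunOn ℚ C (q r)) ∧
        (∀ r, ∀ x ∈ C, ∏ i, W i x ^ (f r i) = 1) ∧
        (∀ i, ∀ x ∈ C, h i x = ∑ r, q r x * (f r i : ℝ)) := by
  classical
  -- Step 1: the engine on the cell
  have hV := engine_cell hT hpoly hflat hstab hRP habs horth hCs hCo h W g hhs hWs hgs hhc hWc hgc
    hWpos hrel hdich
  -- Step 2: rational reproduction on the lattice of constant monomials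
  obtain ⟨R, f, Bq, hfΛ, hqs, hrep⟩ := reproduce_on_span hCs h hhs
    {f : Fin k → ℤ | ∃ θ : ℝ, ∀ y ∈ C, ∏ i, W i y ^ (f i) = θ} hV
  choose θ hθ using hfΛ
  set q : Fin R → (Fin n → ℝ) → ℝ := fun r x => ∑ i', (Bq r i' : ℝ) * h i' x with hq
  have hqc : ∀ r, ContinuousOn (q r) C := fun r =>
    continuousOn_finsetSum _ fun i' _ => continuousOn_const.mul (hhc i').continuousOn
  -- the identity in constant logarithms
  have hglog : ∀ x ∈ C, ∑ r, q r x * Real.log (θ r) = g x := by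
    intro x hx
    rw [← hrel x hx]
    have hWx : ∀ i, 0 < W i x := fun i => hWpos i x hx
    calc ∑ r, q r x * Real.log (θ r)
        = ∑ r, q r x * ∑ i, (f r i : ℝ) * Real.log (W i x) := by
          refine Finset.sum_congr rfl fun r _ => ?_
          rw [sum_intCast_mul_log _ _ hWx, hθ r x hx]
      _ = ∑ i, (∑ r, q r x * (f r i : ℝ)) * Real.log (W i x) := by
          simp only [Finset.mul_sum, Finset.sum_mul]
          rw [Finset.sum_comm]
          refine Finset.sum_congr rfl fun i _ => Finset.sum_congr rfl fun r _ => ?_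
          ring
      _ = ∑ i, h i x * Real.log (W i x) := by
          refine Finset.sum_congr rfl fun i _ => ?_
          rw [hrep i x hx]
  -- Step 3: the lattice of EXACT relations
  set Λ₁ : Set (Fin k → ℤ) := {F | ∀ y ∈ C, ∏ i, W i y ^ (F i) = 1} with hΛ₁
  have hV₁ : ∀ x ∈ C, (fun i => h i x) ∈
      Submodule.span ℝ {φ : Fin k → ℝ | ∃ F ∈ Λ₁, φ = fun i => (F i : ℝ)} := by
    by_cases hCne : C.Nonempty
    · -- constant block
      obtain ⟨z, hz⟩ := hCne
      obtain ⟨zq, hzq⟩ := descent_exists_ratCast_mem hCo hz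
      have hθalg : ∀ r, IsAlgebraic ℚ (θ r) := by
        intro r
        rw [← hθ r _ hzq]
        refine Finset.prod_induction _ (fun t => IsAlgebraic ℚ t) (fun a b ha hb => ha.mul hb)
          isAlgebraic_one fun i _ => ?_
        have hWalg : IsAlgebraic ℚ (W i fun j => (zq j : ℝ)) :=
          Summit.KontsevichZagierPeriods.GammaHodgeSectorNegative.isAlgebraic_apply_ratCast (hWs i) zq hzq
        rcases Int.eq_nat_or_neg (f r i) with ⟨m, hm | hm⟩
        · rw [hm, zpow_natCast]
          exact hWalg.pow m
        · rw [hm, zpow_neg, zpow_natCast]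
          exact (hWalg.pow m).inv
      have hθpos : ∀ r, 0 < θ r := fun r => by
        rw [← hθ r _ hzq]
        exact Finset.prod_pos fun i _ => zpow_pos (hWpos i _ hzq) _
      have hspanq := hconst n R C q g θ hCs hCo hqs hqc hgs hθalg hθpos hglog
      -- push the span of relations forward along `c ↦ Σ_r c_r f_r`
      intro x hx
      let Φ : (Fin R → ℝ) →ₗ[ℝ] (Fin k → ℝ) :=
        { toFun := fun c i => ∑ r, c r * (f r i : ℝ)
          map_add' := fun c c' => by ext i; simp [add_mul, Finset.sum_add_distrib]
          map_smul' := fun a c => by ext i; simp [Finset.mul_sum, mul_assoc] }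
      have hΦq : Φ (fun r => q r x) = fun i => h i x := by
        ext i
        exact (hrep i x hx).symm
      rw [← hΦq]
      have hle : (Submodule.span ℝ {φ : Fin R → ℝ | ∃ m : Fin R → ℤ, ∏ r, θ r ^ (m r) = 1 ∧
          φ = fun r => (m r : ℝ)}).map Φ ≤
          Submodule.span ℝ {φ : Fin k → ℝ | ∃ F ∈ Λ₁, φ = fun i => (F i : ℝ)} := by
        rw [Submodule.map_span_le]
        rintro _ ⟨m, hm, rfl⟩
        refine Submodule.subset_span ⟨fun i => ∑ r, m r * f r i, fun y hy => ?_, ?_⟩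
        · rw [prod_zpow_sum_eq _ (fun i => hWpos i y hy), ← hm]
          exact Finset.prod_congr rfl fun r _ => by rw [hθ r y hy]
        · ext i
          simp [Φ]
      exact hle ⟨_, hspanq x hx, rfl⟩
    · intro x hx
      exact absurd ⟨x, hx⟩ hCne
  -- Step 4: reproduce on the exact lattice
  obtain ⟨R', f', Bq', hf'Λ, hq's, hrep'⟩ := reproduce_on_span hCs h hhs Λ₁ hV₁
  refine ⟨fun x hx => ?_, R', f', fun r x => ∑ i', (Bq' r i' : ℝ) * h i' x, hq's,
    fun r x hx => hf'Λ r x hx, hrep'⟩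
  -- `g ≡ 0`
  rw [← hrel x hx]
  have hWx : ∀ i, 0 < W i x := fun i => hWpos i x hx
  set c : Fin R' → ℝ := fun r => ∑ i', (Bq' r i' : ℝ) * h i' x with hc
  calc ∑ i, h i x * Real.log (W i x)
      = ∑ i, (∑ r, c r * (f' r i : ℝ)) * Real.log (W i x) := by
        refine Finset.sum_congr rfl fun i _ => ?_
        rw [← hrep' i x hx]
    _ = ∑ r, c r * ∑ i, (f' r i : ℝ) * Real.log (W i x) := by
        simp only [Finset.mul_sum, Finset.sum_mul]
        rw [Finset.sum_comm]
        refine Finset.sum_congr rfl fun r _ => Finset.sum_congr rfl fun i _ => ?_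
        ring
    _ = 0 := by
        refine Finset.sum_eq_zero fun r _ => ?_
        rw [sum_intCast_mul_log _ _ hWx, hf'Λ r x hx, Real.log_one, mul_zero]

end CellStructure

/-! ### The structure theorem (registered stub `stub_structure`) -/

/-- **STRUCTURE THEOREM** (registered stub `stub_structure` of line `ax-schanuel-germs`): from the six engine stubs (Taylor morphism, one-variable semialgebraic toolkit, Rosenlicht property, abstract log-linear rigidity + double orthogonality, constant block, uniform cells), the structure of `ℚ`-semialgebraic log-linear identities `Σ hᵢ log Wᵢ = g`: finitely many disjoint open semialgebraic cells, co-null, on each of which `g ≡ 0` and `h = Σ_r q_r f_r` with `q_r` `ℚ`-semialgebraic and `Π Wᵢ^{f_r i} ≡ 1`. -/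
theorem stub_structure :
    (∃ T : (ℝ → ℝ) → ℝ⸨X⸩, (∀ f g : ℝ→ℝ, f =ᶠ[𝓝 0] g → T f = T g)∧(∀ f g : ℝ→ℝ, (∃ U ∈ 𝓝 (0:ℝ),
    ContDiffOn ℝ ∞ f U)→(∃ U ∈ 𝓝 (0:ℝ), ContDiffOn ℝ ∞ g U) → T (f + g) = T f + T g ∧ T (f * g) =
    T f * T g)∧(∀ f : ℝ → ℝ, (∃ U ∈ 𝓝 (0:ℝ), ContDiffOn ℝ ∞ f U) → T (deriv f) =
    LaurentSeries.derivative ℝ (T f))∧(∀ c : ℝ, T (fun _ => c) = HahnSeries.C c) ∧ T (fun t => t)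
    = HahnSeries.single 1 1 ∧ (∀ f : ℝ → ℝ, ∃ p : PowerSeries ℝ, T f = HahnSeries.ofPowerSeries ℤ
    ℝ p)∧(∀ f : ℝ → ℝ, (T f).coeff 0 = f 0)∧(∀ f : ℝ → ℝ, (∃ U ∈ 𝓝 (0:ℝ), ContDiffOn ℝ ∞ f U)→(T
    f = 0 ↔ ∀ n : ℕ, iteratedDeriv n f 0 = 0)))→((∀ (φ : ℝ → ℝ) (a b : ℝ), a < b →
    IsSemialgebraicFunOn ℝ {x : Fin 1 → ℝ | x 0 ∈ Ioo a b} (fun x => φ (x 0)) → ∃ q :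
    MvPolynomial (Fin 2) ℝ, q ≠ 0 ∧ ∀ t ∈ Ioo a b, MvPolynomial.eval (Fin.cons (φ t) fun _ => t)
    q = 0)∧(∀ (φ : ℝ → ℝ) (ε : ℝ), 0 < ε → IsSemialgebraicFunOn ℝ {x : Fin 1 → ℝ | x 0 ∈ Ioo (-ε)
    ε} (fun x => φ (x 0)) → ContDiffOn ℝ ∞ φ (Ioo (-ε) ε)→(∀ n : ℕ, iteratedDeriv n φ 0 = 0) → ∀ᶠ
    t in 𝓝 (0:ℝ), φ t = 0))→((∀ x : ℝ⸨X⸩, IsAlgebraic (RatFunc ℝ) x → IsAlgebraic (RatFunc ℝ)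
    (LaurentSeries.derivative ℝ x))∧(∀ (m : ℕ) (e : Fin m → ℝ) (u : Fin m → ℝ⸨X⸩) (v : ℝ⸨X⸩),
    LinearIndependent ℚ e → (∀ j, IsAlgebraic (RatFunc ℝ) (u j))→(∀ j, u j ≠ 0) → IsAlgebraic
    (RatFunc ℝ) v → (∑ j, HahnSeries.C (e j) * ((u j)⁻¹ * LaurentSeries.derivative ℝ (u j))) +
    LaurentSeries.derivative ℝ v = 0 → ∀ j, LaurentSeries.derivative ℝ (u j) = 0))→((∀ (L : Type)
    [Field L] [CharZero L] (D : Derivation ℤ L L) (F : Subfield L), (∀ x ∈ F, D x ∈ F)→(∀ x, D x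
    = 0 → x ∈ F)→(∀ (m : ℕ) (c u : Fin m → L) (v : L), (∀ j, D (c j) = 0) → LinearIndependent ℚ c
    → (∀ j, u j ∈ F)→(∀ j, u j ≠ 0) → v ∈ F → (∑ j, c j * ((u j)⁻¹ * D (u j))) + D v = 0 → ∀ j, D
    (u j) = 0) → ∀ (k : ℕ) (η w y : Fin k → L) (g : L), (∀ i, η i ∈ F)→(∀ i, w i ∈ F)→(∀ i, w i ≠
    0)→(∀ i, D (y i) = (w i)⁻¹ * D (w i)) → g ∈ F → ∑ i, η i * y i = g → ∀ p : Fin k → ℤ, (∀ f :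
    Fin k → ℤ, D (∑ i, (f i : L) * y i) = 0 → ∑ i, p i * f i = 0) → ∑ i, (p i : L) * η i = 0)∧(∀
    (k : ℕ) (S : Set (Fin k → ℤ)) (v : Fin k → ℝ), (∀ p : Fin k → ℤ, (∀ f ∈ S, ∑ i, p i * f i =
    0) → ∑ i, (p i : ℝ) * v i = 0) → v ∈ Submodule.span ℝ {φ : Fin k → ℝ | ∃ f ∈ S, φ = fun i =>
    (f i : ℝ)}))→(∀ (n R : ℕ) (C : Set (Fin n → ℝ)) (q : Fin R → (Fin n → ℝ) → ℝ) (g : (Fin n →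
    ℝ) → ℝ) (θ : Fin R → ℝ), IsSemialgebraic ℚ C → IsOpen C → (∀ r, IsSemialgebraicFunOn ℚ C (q
    r))→(∀ r, ContinuousOn (q r) C) → IsSemialgebraicFunOn ℚ C g → (∀ r, IsAlgebraic ℚ (θ r))→(∀
    r, 0 < θ r)→(∀ x ∈ C, ∑ r, q r x * Real.log (θ r) = g x) → ∀ x ∈ C, (fun r => q r x) ∈
    Submodule.span ℝ {φ : Fin R → ℝ | ∃ m : Fin R → ℤ, ∏ r, θ r ^ (m r) = 1 ∧ φ = fun r => (m r :
    ℝ)})→(∀ (n k M : ℕ) (U : Set (Fin n → ℝ)) (W : Fin k → (Fin n → ℝ) → ℝ) (F : Fin M → (Fin n →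
    ℝ) → ℝ), IsSemialgebraic ℚ U → (∀ i, IsSemialgebraicFunOn ℚ U (W i))→(∀ i, ∀ x ∈ U, 0 < W i
    x)→(∀ m, IsSemialgebraicFunOn ℚ U (F m)) → ∃ (N : ℕ) (C : Fin N → Set (Fin n → ℝ)), (∀ c,
    IsSemialgebraic ℚ (C c) ∧ IsOpen (C c) ∧ IsPreconnected (C c) ∧ C c ⊆ U) ∧ Pairwise
    (Function.onFun Disjoint C) ∧ volume (U \ ⋃ c, C c) = 0 ∧ (∀ c i, ContDiffOn ℝ ∞ (W i) (C
    c))∧(∀ c m, ContDiffOn ℝ ∞ (F m) (C c)) ∧ ∀ c (f : Fin k → ℤ), (∃ θ : ℝ, ∀ x ∈ C c, ∏ i, W i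
    x ^ (f i) = θ) ∨ interior {x ∈ C c | ∀ j : Fin n, ∑ i, (f i : ℝ) * (fderiv ℝ (W i) x
    (Pi.single j 1) / W i x) = 0} = ∅) → ∀ (n k : ℕ) (U : Set (Fin n → ℝ)) (h W : Fin k → (Fin n
    → ℝ) → ℝ) (g : (Fin n → ℝ) → ℝ), IsSemialgebraic ℚ U → (∀ i, IsSemialgebraicFunOn ℚ U (h
    i))→(∀ i, IsSemialgebraicFunOn ℚ U (W i))→(∀ i, ∀ x ∈ U, 0 < W i x) → IsSemialgebraicFunOn ℚ
    U g → (∀ x ∈ U, ∑ i, h i x * Real.log (W i x) = g x) → ∃ (N : ℕ) (C : Fin N → Set (Fin n →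
    ℝ)), (∀ c, IsSemialgebraic ℚ (C c) ∧ IsOpen (C c) ∧ C c ⊆ U) ∧ Pairwise (Function.onFun
    Disjoint C) ∧ volume (U \ ⋃ c, C c) = 0 ∧ ∀ c, (∀ x ∈ C c, g x = 0) ∧ ∃ (R : ℕ) (f : Fin R →
    Fin k → ℤ) (q : Fin R → (Fin n → ℝ) → ℝ), (∀ r, IsSemialgebraicFunOn ℚ (C c) (q r))∧(∀ r, ∀ x
    ∈ C c, ∏ i, W i x ^ (f r i) = 1)∧(∀ i, ∀ x ∈ C c, h i x = ∑ r, q r x * (f r i : ℝ)) := by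
  intro hT hone hRos habs hconst huc n k U h W g hU hhs hWs hWpos hgs hrel
  obtain ⟨hpoly, hflat⟩ := hone
  obtain ⟨hstab, hRP⟩ := hRos
  obtain ⟨habs1, horth⟩ := habs
  -- the data to be smoothed on the cells: `h₀, …, h_{k-1}, g`
  have hFs : ∀ m : Fin (k + 1), IsSemialgebraicFunOn ℚ U
      ((Fin.snoc h g : Fin (k + 1) → (Fin n → ℝ) → ℝ) m) := fun m => by
    refine Fin.lastCases ?_ (fun i => ?_) m
    · simpa using hgs
    · simpa using hhs i
  obtain ⟨N, C, hC, hdisj, hnull, hWsm, hFsm, hdich⟩ :=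
    huc n k (k + 1) U W (Fin.snoc h g) hU hWs hWpos hFs
  refine ⟨N, C, fun c => ⟨(hC c).1, (hC c).2.1, (hC c).2.2.2⟩, hdisj, hnull, fun c => ?_⟩
  have hsub : C c ⊆ U := (hC c).2.2.2
  have hhc : ∀ i, ContDiffOn ℝ ∞ (h i) (C c) := fun i => by
    simpa using hFsm c (Fin.castSucc i)
  have hgc : ContDiffOn ℝ ∞ g (C c) := by simpa using hFsm c (Fin.last k)
  exact structure_on_cell hT hpoly hflat hstab hRP habs1 horth hconst (hC c).1 (hC c).2.1 h W g
    (fun i => (hhs i).mono hsub (hC c).1) (fun i => (hWs i).mono hsub (hC c).1)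
    (hgs.mono hsub (hC c).1) hhc (hWsm c) hgc (fun i x hx => hWpos i x (hsub hx))
    (fun x hx => hrel x (hsub hx)) (hdich c)

end Summit.KontsevichZagierPeriods.LiouvilleUnfolding.LogPrimitiveNL.AxSchanuelGerms

end
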